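import Literature.AnabelianGeometry.AbsoluteAnabelian.MLFGaloisPairs

/-!
# The model MLF-Galois `T`-pairs as named pairs; `Π_k ↷ k̄ˣ`; the cyclotome of `𝒪_k̄^⊳` is `Ẑ(1)`
# ([AbsTopIII] Def 3.1 (i)/(ii), Rmk 3.2.1 — for the MODEL)

First of two companion files of `MonoidKummerMaps.lean` that CONSTRUCT, for the model data
`(k, k̄, ε_k : Π_k ↠ G_k)` of [AbsTopIII] Def. 3.1 (i) (`MLFClosure` + `ModelMLFGaloisData`, file
`MLFGaloisModel.lean`), the objects which Prop. 3.2 types abstractly (S. Mochizuki, *Topics in absolute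
anabelian geometry III*, §3; bib key `MochizukiAbsTopIII2015`, locators = kurims manuscript pages, lit key
`paper:url-5493eb38cbb7`).  This file (Mathlib + the two Def. 3.1 files + the tree's cyclotome only):

* `GaloisMonoidPair.Iso.refl`; the actions `Π_k ↷ k̄ˣ, 𝒪_k̄^⊳, 𝒪_k̄^×, k̄^×` through `ε_k` as instances
  (`ModelMLFGaloisData.unitsAction`, `.nonzeroIntegersAction`, `.unitSubmonoidAction`,
  `.nonZeroDivisorsAction` — the same terms as inside `ModelMLFGaloisData.monoidPair`);
* the model pairs as NAMED pairs `ModelMLFGaloisData.tmPair / tcgPair / tlgPair` with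
  `monoidPair_TM : D.monoidPair .TM = some D.tmPair` (`rfl`) etc., and the non-vacuity of Def. 3.1 (ii):
  `isMLFGaloisMonoidPair_tmPair / _tcgPair / _tlgPair` (every model pair is an MLF-Galois pair);
* `ModelMLFGaloisData.toUnit : 𝒪_k̄^⊳ → k̄ˣ` (multiplicative, injective, `Π_k`-equivariant);
* `IsAlgClosed.rootableByUnits` (every unit of an algebraically closed field has `n`-th roots, `n ≥ 1`;
  hypothesis (a) of the Kummer machinery of `EtaleTheta/KummerClass.lean`, [LANA2026Report] §6.1) and
  its instance `MLFClosure.rootableByUnits` for `k̄`;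
* **Rmk 3.2.1 for the model**: `MLFClosure.cyclotomeUnitsEquiv : μ_Ẑ(𝒪_k̄^⊳) = Λ((𝒪_k̄^⊳)ˣ) ⥲ Λ(k̄ˣ) = Ẑ(1)`,
  the map induced by `𝒪_k̄^⊳ ⊆ k̄`, PROVED bijective (every compatible system of roots of unity of `k̄`
  consists of units of the monoid `𝒪_k̄^⊳`) — the identification "`Λ(K̄_v^×) = Λ(𝒪^×_v)`" used without
  proof in LANA §4.2 (b).

The Kummer theory proper (Prop. 3.2 (ii)(iii)(v): `ContCohomologyData` inhabited, `MonoidKummerTheory`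
of the model built, injectivity) is the second file, `MonoidKummerModel.lean`.
HONEST FRAMING: OUR kernel constructions of classical objects named by a refereed paper; nothing here
bears on [IUTchIII] Cor. 3.12.
-/

noncomputable section

universe u

namespace Literature.AnabelianGeometry.AbsoluteAnabelian

open _root_.Topology
open scoped _root_.ValuativeRel
/-! ### The identity isomorphism; rootability of `k̄ˣ`; the model actions and pairs -/

/-- The identity isomorphism of a pair `(Π ↷ M)`. [cite: MochizukiAbsTopIII2015, Definition 3.1 (ii) p.67] -/
def GaloisMonoidPair.Iso.refl (P : GaloisMonoidPair.{u}) : GaloisMonoidPair.Iso P P where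
  isoPi := ContinuousMulEquiv.refl P.Pi
  isoM := MulEquiv.refl P.M
  smul_comm _ _ := rfl

/-- The unit group of an algebraically closed field is rootable: every `u ∈ Kˣ` has an `n`-th root for
every `n ≥ 1` (Mathlib `IsAlgClosed.exists_pow_nat_eq`) — hypothesis (a) "`M^gp` is `n`-divisible" of the
Kummer machinery.  A reducible `def`, instantiated below only for the algebraic closure `k̄` of model
data (`MLFClosure.rootableByUnits`), not a global instance for all algebraically closed fields.
[cite: LANA2026Report, §6.1 p.31] -/
@[reducible] def IsAlgClosed.rootableByUnits (K : Type u) [Field K] [IsAlgClosed K] : RootableBy Kˣ ℕ where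
  root u n := if hn : n = 0 then 1 else
    Units.mk0 (Classical.choose (IsAlgClosed.exists_pow_nat_eq (u : K) (Nat.pos_of_ne_zero hn)))
      (by
        intro h0
        have h := Classical.choose_spec (IsAlgClosed.exists_pow_nat_eq (u : K) (Nat.pos_of_ne_zero hn))
        rw [h0, zero_pow hn] at h
        exact u.ne_zero h.symm)
  root_zero u := by simp
  root_cancel {n} u hn := by
    simp only [hn, ↓reduceDIte]
    ext
    rw [Units.val_pow_eq_pow_val, Units.val_mk0]
    exact Classical.choose_spec (IsAlgClosed.exists_pow_nat_eq (u : K) (Nat.pos_of_ne_zero hn))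

namespace ModelMLFGaloisData

section UnitsAction

variable {k : Type u} [Field k] {K : Type u} [Field K] [Algebra k K] (D : ModelMLFGaloisData k K)

/-- **`Π_k ↷ k̄ˣ`** through `ε_k : Π_k ↠ G_k` (the field action restricted to units). [cite: MochizukiAbsTopIII2015, Definition 3.1 (i) p.66] -/
instance unitsAction : MulDistribMulAction D.Pi Kˣ where
  smul g u := Units.map (MulDistribMulAction.toMonoidHom K (D.aug g)) u
  one_smul u := Units.ext (by
    change D.aug 1 • (u : K) = u
    rw [map_one, one_smul])
  mul_smul g h u := Units.ext (by
    change D.aug (g * h) • (u : K) = D.aug g • (D.aug h • (u : K))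
    rw [map_mul, mul_smul])
  smul_mul g u v := Units.ext (smul_mul' (D.aug g) (u : K) (v : K))
  smul_one g := Units.ext (smul_one (D.aug g))

/-- The action on units, on underlying elements. [cite: MochizukiAbsTopIII2015, Definition 3.1 (i) p.66] -/
@[simp] theorem units_coe_smul (g : D.Pi) (u : Kˣ) : ((g • u : Kˣ) : K) = D.aug g • (u : K) := rfl

end UnitsAction

section Submonoids

variable {k : Type u} [Field k] [ValuativeRel k] {K : Type u} [Field K] [Algebra k K]

/-- The unit of `k̄` underlying a non-zero integer `m ∈ 𝒪_k̄^⊳`. [cite: MochizukiAbsTopIII2015, Definition 3.1 (i) p.66] -/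
def toUnit (m : nonzeroIntegers k K) : Kˣ := Units.mk0 (m : K) m.2.2

/-- `toUnit` on underlying elements. [cite: MochizukiAbsTopIII2015, Definition 3.1 (i) p.66] -/
@[simp] theorem coe_toUnit (m : nonzeroIntegers k K) : (toUnit m : K) = m := rfl

/-- `toUnit` is multiplicative. [cite: MochizukiAbsTopIII2015, Definition 3.1 (i) p.66] -/
theorem toUnit_mul (m m' : nonzeroIntegers k K) : toUnit (m * m') = toUnit m * toUnit m' :=
  Units.ext rfl

/-- `toUnit` is injective. [cite: MochizukiAbsTopIII2015, Definition 3.1 (i) p.66] -/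
theorem toUnit_injective : Function.Injective (toUnit (k := k) (K := K)) := fun m m' h =>
  Subtype.ext (by simpa using congrArg (fun u : Kˣ => (u : K)) h)

variable (D : ModelMLFGaloisData k K)

/-- `Π_k ↷ 𝒪_k̄^⊳` through `ε_k` (the action of the model `TM`-pair, as an instance).
[cite: MochizukiAbsTopIII2015, Definition 3.1 (i) p.67] -/
instance nonzeroIntegersAction : MulDistribMulAction D.Pi (nonzeroIntegers k K) :=
  D.submonoidAction (nonzeroIntegers k K) (fun σ _ h => smul_mem_nonzeroIntegers σ h)

/-- `Π_k ↷ 𝒪_k̄^×` through `ε_k` (the action of the model `TCG`-pair, as an instance).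
[cite: MochizukiAbsTopIII2015, Definition 3.1 (i) p.67] -/
instance unitSubmonoidAction : MulDistribMulAction D.Pi (unitSubmonoid k K) :=
  D.submonoidAction (unitSubmonoid k K) (fun σ _ h => smul_mem_unitSubmonoid σ h)

/-- `Π_k ↷ k̄^×` through `ε_k` (the action of the model `TLG`-pair, as an instance).
[cite: MochizukiAbsTopIII2015, Definition 3.1 (i) p.67] -/
instance nonZeroDivisorsAction : MulDistribMulAction D.Pi (nonZeroDivisors K) :=
  D.submonoidAction (nonZeroDivisors K) (fun σ _ h => smul_mem_nonZeroDivisors σ h)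

/-- The action on `𝒪_k̄^⊳`, on underlying elements of `k̄`: `g • m = ε_k(g)(m)`.
[cite: MochizukiAbsTopIII2015, Definition 3.1 (i) p.67] -/
@[simp] theorem nonzeroIntegers_coe_smul (g : D.Pi) (m : nonzeroIntegers k K) :
    ((g • m : nonzeroIntegers k K) : K) = D.aug g • (m : K) := rfl

/-- `toUnit` is `Π_k`-equivariant. [cite: MochizukiAbsTopIII2015, Definition 3.1 (i) p.66] -/
theorem smul_toUnit (g : D.Pi) (m : nonzeroIntegers k K) : g • toUnit m = toUnit (g • m) :=
  Units.ext rfl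

variable [Algebra.IsAlgebraic k K]

/-- The **model MLF-Galois `TM`-pair** `(Π_k ↷ 𝒪_k̄^⊳)` as a named pair (the `TM` branch of
`ModelMLFGaloisData.monoidPair`). [cite: MochizukiAbsTopIII2015, Definition 3.1 (i) p.67] -/
abbrev tmPair : GaloisMonoidPair.{u} where
  Pi := D.Pi
  M := nonzeroIntegers k K
  instAction := D.nonzeroIntegersAction
  isOpen_stabilizer x := by
    convert D.isOpen_stabilizer_comp (x : K) using 1
    ext σ
    exact Subtype.ext_iff

/-- The **model MLF-Galois `TCG`-pair** `(Π_k ↷ 𝒪_k̄^×)`. [cite: MochizukiAbsTopIII2015, Definition 3.1 (i) p.67] -/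
abbrev tcgPair : GaloisMonoidPair.{u} where
  Pi := D.Pi
  M := unitSubmonoid k K
  instAction := D.unitSubmonoidAction
  isOpen_stabilizer x := by
    convert D.isOpen_stabilizer_comp (x : K) using 1
    ext σ
    exact Subtype.ext_iff

/-- The **model MLF-Galois `TLG`-pair** `(Π_k ↷ k̄^×)`. [cite: MochizukiAbsTopIII2015, Definition 3.1 (i) p.67] -/
abbrev tlgPair : GaloisMonoidPair.{u} where
  Pi := D.Pi
  M := nonZeroDivisors K
  instAction := D.nonZeroDivisorsAction
  isOpen_stabilizer x := by
    convert D.isOpen_stabilizer_comp (x : K) using 1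
    ext σ
    exact Subtype.ext_iff

/-- `monoidPair TM` is the model `TM`-pair. [cite: MochizukiAbsTopIII2015, Definition 3.1 (i) p.67] -/
theorem monoidPair_TM : D.monoidPair .TM = some D.tmPair := rfl

/-- `monoidPair TCG` is the model `TCG`-pair. [cite: MochizukiAbsTopIII2015, Definition 3.1 (i) p.67] -/
theorem monoidPair_TCG : D.monoidPair .TCG = some D.tcgPair := rfl

/-- `monoidPair TLG` is the model `TLG`-pair. [cite: MochizukiAbsTopIII2015, Definition 3.1 (i) p.67] -/
theorem monoidPair_TLG : D.monoidPair .TLG = some D.tlgPair := rfl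

end Submonoids

end ModelMLFGaloisData

section NonVacuity

variable (C : MLFClosure.{u}) (D : ModelMLFGaloisData C.k C.K)

/-- **Non-vacuity of Def. 3.1 (ii) for `T = TM`**: the model `TM`-pair of any model data is an MLF-Galois
`TM`-pair (via the identity isomorphism). [cite: MochizukiAbsTopIII2015, Definition 3.1 (ii) p.67] -/
theorem isMLFGaloisMonoidPair_tmPair : IsMLFGaloisMonoidPair .TM D.tmPair :=
  ⟨⟨C, D, D.tmPair, D.monoidPair_TM, ⟨GaloisMonoidPair.Iso.refl _⟩⟩⟩

/-- Non-vacuity of Def. 3.1 (ii) for `T = TCG`. [cite: MochizukiAbsTopIII2015, Definition 3.1 (ii) p.67] -/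
theorem isMLFGaloisMonoidPair_tcgPair : IsMLFGaloisMonoidPair .TCG D.tcgPair :=
  ⟨⟨C, D, D.tcgPair, D.monoidPair_TCG, ⟨GaloisMonoidPair.Iso.refl _⟩⟩⟩

/-- Non-vacuity of Def. 3.1 (ii) for `T = TLG`. [cite: MochizukiAbsTopIII2015, Definition 3.1 (ii) p.67] -/
theorem isMLFGaloisMonoidPair_tlgPair : IsMLFGaloisMonoidPair .TLG D.tlgPair :=
  ⟨⟨C, D, D.tlgPair, D.monoidPair_TLG, ⟨GaloisMonoidPair.Iso.refl _⟩⟩⟩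

end NonVacuity

/-! ### Rmk 3.2.1 for the model: `μ_Ẑ(𝒪_k̄^⊳) ⥲ Ẑ(1) = Λ(k̄ˣ)` -/

section Cyclotome

variable (C : MLFClosure.{u})

namespace MLFClosure

/-- A root of unity of `k̄` is a non-zero integer. [cite: MochizukiAbsTopIII2015, Definition 3.1 (v) p.69] -/
theorem mem_nonzeroIntegers_of_pow_eq_one {z : C.K} {n : ℕ} (hn : 0 < n) (hz : z ^ n = 1) :
    z ∈ nonzeroIntegers C.k C.K := by
  refine ⟨?_, ?_⟩
  · show IsIntegral 𝒪[C.k] z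
    exact IsIntegral.of_pow hn (by rw [hz]; exact isIntegral_one)
  · rintro rfl
    rw [zero_pow hn.ne'] at hz
    exact zero_ne_one hz

/-- A root of unity `z ∈ k̄ˣ` (`z ^ n = 1`) as a unit of the MONOID `𝒪_k̄^⊳` (its inverse is again a root
of unity, hence a non-zero integer). [cite: MochizukiAbsTopIII2015, Definition 3.1 (v) p.69] -/
def rootOfUnityUnit (z : (C.K)ˣ) {n : ℕ} (hn : 0 < n) (hz : z ^ n = 1) : (nonzeroIntegers C.k C.K)ˣ where
  val := ⟨(z : C.K), C.mem_nonzeroIntegers_of_pow_eq_one hn (by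
    rw [← Units.val_pow_eq_pow_val, hz, Units.val_one])⟩
  inv := ⟨((z⁻¹ : (C.K)ˣ) : C.K), C.mem_nonzeroIntegers_of_pow_eq_one hn (by
    rw [← Units.val_pow_eq_pow_val, inv_pow, hz, inv_one, Units.val_one])⟩
  val_inv := Subtype.ext (by simp)
  inv_val := Subtype.ext (by simp)

/-- The natural map `Λ((𝒪_k̄^⊳)ˣ) → Λ(k̄ˣ)` induced by `𝒪_k̄^⊳ ⊆ k̄`.
[cite: MochizukiAbsTopIII2015, Remark 3.2.1 p.72] -/
def cyclotomeUnitsHom : cyclotome (nonzeroIntegers C.k C.K) →* EtaleTheta.cyclotome (C.K)ˣ :=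
  EtaleTheta.cyclotome.map (Units.map (nonzeroIntegers C.k C.K).subtype)

/-- Components of `cyclotomeUnitsHom`. [cite: MochizukiAbsTopIII2015, Remark 3.2.1 p.72] -/
@[simp] theorem coe_cyclotomeUnitsHom_apply (ζ : cyclotome (nonzeroIntegers C.k C.K)) (n : ℕ+) :
    (((C.cyclotomeUnitsHom ζ : EtaleTheta.cyclotome (C.K)ˣ) : ℕ+ → (C.K)ˣ) n : C.K) =
      (((ζ : ℕ+ → (nonzeroIntegers C.k C.K)ˣ) n : nonzeroIntegers C.k C.K) : C.K) := rfl

/-- `Λ((𝒪_k̄^⊳)ˣ) → Λ(k̄ˣ)` is bijective: injective since `𝒪_k̄^⊳ ⊆ k̄` is, surjective since every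
compatible system of roots of unity of `k̄` consists of units of `𝒪_k̄^⊳`.
[cite: MochizukiAbsTopIII2015, Remark 3.2.1 p.72] -/
theorem cyclotomeUnitsHom_bijective : Function.Bijective C.cyclotomeUnitsHom := by
  constructor
  · intro ζ ξ h
    refine Subtype.ext (funext fun n => Units.ext (Subtype.ext ?_))
    have := congrArg (fun η : EtaleTheta.cyclotome (C.K)ˣ => (((η : ℕ+ → (C.K)ˣ) n : (C.K)ˣ) : C.K)) h
    simpa using this
  · intro ζ
    refine ⟨⟨fun n => C.rootOfUnityUnit ((ζ : ℕ+ → (C.K)ˣ) n) n.pos (ζ.2.1 n), ?_, ?_⟩, ?_⟩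
    · intro n
      refine Units.ext (Subtype.ext ?_)
      have h := congrArg (fun u : (C.K)ˣ => (u : C.K)) (ζ.2.1 n)
      simpa [rootOfUnityUnit, Units.val_pow_eq_pow_val] using h
    · intro n m
      refine Units.ext (Subtype.ext ?_)
      have h := congrArg (fun u : (C.K)ˣ => (u : C.K)) (ζ.2.2 n m)
      simpa [rootOfUnityUnit, Units.val_pow_eq_pow_val] using h
    · exact Subtype.ext (funext fun n => Units.ext rfl)

/-- **Rmk 3.2.1 for the model**: the natural isomorphism `μ_Ẑ(𝒪_k̄^⊳) = Λ((𝒪_k̄^⊳)ˣ) ⥲ Λ(k̄ˣ) = Ẑ(1)`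
("a functorial algorithm for constructing the natural isomorphism `μ_Ẑ(M_TM) ⥲ μ_Ẑ(G)`" — here with
the field-theoretic cyclotome `Ẑ(1)` of `k̄` in the role of `μ_Ẑ(G)`).
[cite: MochizukiAbsTopIII2015, Remark 3.2.1 p.72] -/
def cyclotomeUnitsEquiv : cyclotome (nonzeroIntegers C.k C.K) ≃* EtaleTheta.cyclotome (C.K)ˣ :=
  MulEquiv.ofBijective C.cyclotomeUnitsHom C.cyclotomeUnitsHom_bijective

end MLFClosure

end Cyclotome

/-! ### Prop 3.2 (ii)/(iii) for the model: the cohomology data and the Kummer theory -/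

section Instances

variable (C : MLFClosure.{u})

/-- `k̄` is algebraically closed (instance form of `IsAlgClosure.isAlgClosed` for model data).
[cite: MochizukiAbsTopIII2015, Definition 3.1 (i) p.66] -/
instance MLFClosure.isAlgClosed_K : IsAlgClosed C.K := IsAlgClosure.isAlgClosed C.k

/-- `k̄ˣ` is rootable (every unit of the algebraic closure has `n`-th roots, `n ≥ 1`): the instance of
`IsAlgClosed.rootableByUnits` for the algebraic closure of model data, so that the Kummer machinery of
`EtaleTheta/KummerClass.lean` applies to `Π_k ↷ k̄ˣ`. [cite: LANA2026Report, §6.1 p.31] -/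
instance MLFClosure.rootableByUnits : RootableBy (C.K)ˣ ℕ := IsAlgClosed.rootableByUnits C.K

end Instances

end Literature.AnabelianGeometry.AbsoluteAnabelian

end
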